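import Summits.CriticalPhenomena.PercolationContinuityZ3.Theorems.PercNearOneGluingNoHeavyLowerTailCILStarTransfer
import Summits.CriticalPhenomena.PercolationContinuityZ3.Theorems.PercNearOneGluingNoHeavyLowerTailCILPortDomination
import HarnessLib

/-!
# `NoHeavyLowerTail` (stmt-CriticalPhenomena-4575) — hull-port line: depth-two hulls reduce to the SPLIT inequalities

Support file (prover `prim-hp-1`, hull-port / coupling line; `--supports stmt-CriticalPhenomena-4575`).  No definitions,
no named facts, no sorries.

Notation: `μ = prodBernoulli w` on `Fin n`, relays `A`, level `j`, observer `o ∉ A`; `H`-reachability `~'` = open paths using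
no pair at `o` (the graph `G − o`), `π'(y)` / `π'(B)` the relays `~'`-joined to `y` / to some member of `B`,
`s(y) = μ{|π'(y)| ≤ j}` the `H`-lightness, and for a set `B` of vertices and a relay `b`
`CS_H(B, b) : μ(b ≁' B, 1 ≤ |π'(B)| ≤ j) ≤ μ(b ≁' B, |π'(b)| ≤ j)`.

A DEPTH-TWO observer is one whose positive-weight neighbours are relays and non-relays `x` that are themselves
relay-neighboured in `G − o` (every positive-weight pair at `x` other than `o–x` ends in a relay).  The hull-port conjecture
(lead gen 1; crux evidence LEAD-GEN1.md, HULLPORT-COUPLING.md) asks that every relay `b` dominating all hull ports in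
`H`-lightness be a CIL witness.  This file proves the exact reduction of the depth-two case to the SPLIT inequalities of
HULLPORT-COUPLING.md §2(b):

* `HullPort.steiner_singleton_CS` — for a relay-neighboured (in `G − o`) non-relay `x` and a relay `b` dominating the relay
  neighbours of `x` in `H`-lightness, `CS_H({x}, b)` holds (it is the self-referenced relay-port CIL
  `Theorems.cil_of_portDomination` for `x` in `G − o`, minus the common part on `{x ~' b}`).
* `HullPort.cil_depthTwo_of_split` — for a depth-two observer `o` and a relay `b` dominating (in `H`-lightness) every relay
  adjacent to `o` or to a non-relay neighbour of `o`: IF `CS_H(B, b)` holds for every set `B` of at least TWO non-relay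
  neighbours of `o` (these are exactly the instances of split(|B|) in `G − o`), THEN `μ{1 ≤ N ≤ j} ≤ μ{|π(b)| ≤ j}`.
  Proof: the star transfer `Theorems.cil_of_starStability` (prover `prim-gen-induct`) with witness `b`; stars containing a
  relay neighbour are not "light"; singleton Steiner stars are `steiner_singleton_CS`; larger Steiner stars are the
  hypothesis.  With ONE non-relay neighbour the hypothesis is void (hulls of size two, cf. `HullPort.hullPort_oneSteiner`);
  with two non-relay neighbours `x, y` exactly one inequality remains, `CS_H({x,y}, b)` = split(2), the open core of the
  hull-port programme (0 violations in the census of HULLPORT-COUPLING.md; kit j047237).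
[cite: VandenbergHaggstromKahn2005, Thm. 1.5 — the only probabilistic input]
-/

noncomputable section

namespace Summit.CriticalPhenomena.PercolationContinuityZ3.Theorems

open MeasureTheory Set Literature.Probability.LatticeModels Literature.Probability.Percolation
open scoped Classical BigOperators

variable {n : ℕ}

namespace HullPort

open CutObserver

/-- On the full-measure event "every open pair has nonzero weight", a non-relay `x` all of whose pairs of nonzero weight
lead nowhere (`u s(x,v) = 0` for all `v ≠ x`) is joined to no relay: `μ(E ∩ {1 ≤ |π(x)| ≤ j}) = 0`. [folklore] -/
theorem measureReal_isolated_light_eq_zero (u : Sym2 (Fin n) → unitInterval) (A : Finset (Fin n)) (x : Fin n)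
    (hxA : x ∉ A) (hiso : ∀ v, v ≠ x → u s(x, v) = 0) (E : Set (BondConfig (Fin n))) (j : ℕ) :
    (prodBernoulli u).real (E ∩ {ω : BondConfig (Fin n) |
        1 ≤ (A.filter fun y => ω ∈ openConn x y).card ∧ (A.filter fun y => ω ∈ openConn x y).card ≤ j}) = 0 := by
  haveI : IsProbabilityMeasure (prodBernoulli u) := inferInstance
  set S := E ∩ {ω : BondConfig (Fin n) |
        1 ≤ (A.filter fun y => ω ∈ openConn x y).card ∧ (A.filter fun y => ω ∈ openConn x y).card ≤ j} with hS
  have hempty : S ∩ {ω : BondConfig (Fin n) | ∀ e ∈ ω, u e ≠ 0} = ∅ := by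
    ext ω
    simp only [mem_inter_iff, mem_setOf_eq, mem_empty_iff_false, iff_false, not_and]
    rintro ⟨_, h1, _⟩ hG
    obtain ⟨y, hy⟩ := Finset.card_pos.1 (by omega : 0 < (A.filter fun y => ω ∈ openConn x y).card)
    rw [Finset.mem_filter] at hy
    have hyx : y ≠ x := fun h => hxA (h ▸ hy.1)
    obtain ⟨wk⟩ := (hy.2 : (openGraph ω).Reachable x y)
    cases wk with
    | nil => exact absurd rfl hyx
    | @cons _ v _ hadj _ =>
      rw [openGraph, SimpleGraph.fromEdgeSet_adj] at hadj
      exact hG _ hadj.1 (hiso v (Ne.symm hadj.2))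
  have := measureReal_inter_support u S
  rw [hempty] at this
  simp only [measureReal_empty] at this
  exact this.symm

/-- **`CS_H({x}, b)` for a relay-neighboured Steiner vertex.**  Let `o` be the observer, `x ∉ A`, `x ≠ o`, every
positive-weight pair at `x` other than `o–x` ending in a relay, and `b ∈ A` at least as `H`-light as every relay neighbour
of `x` (`H` = pairs at `o` removed).  Then `μ(x ≁' b, 1 ≤ |π'(x)| ≤ j) ≤ μ(x ≁' b, |π'(b)| ≤ j)`.  Proof: the self-referenced
relay-port CIL `Theorems.cil_of_portDomination` for `x` in `G − o` gives `μ{1 ≤ |π'(x)| ≤ j} ≤ μ{|π'(b)| ≤ j}`, and on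
`{x ~' b}` the two events coincide (`b ∈ A`). [this file] -/
theorem steiner_singleton_CS (w : Sym2 (Fin n) → unitInterval) (A : Finset (Fin n)) (o x : Fin n) (j : ℕ)
    (hxA : x ∉ A) (hxo : x ≠ o) (hx : ∀ v, v ≠ o → w s(x, v) ≠ 0 → v ∈ A) (b : Fin n) (hbA : b ∈ A)
    (hdom : ∀ q ∈ A, w s(x, q) ≠ 0 →
      (prodBernoulli w).real {ω : BondConfig (Fin n) |
          (A.filter fun z => (openGraph (ω ∩ {e | o ∉ e})).Reachable q z).card ≤ j} ≤
        (prodBernoulli w).real {ω : BondConfig (Fin n) |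
          (A.filter fun z => (openGraph (ω ∩ {e | o ∉ e})).Reachable b z).card ≤ j}) :
    (prodBernoulli w).real {ω : BondConfig (Fin n) |
        ¬ (openGraph (ω ∩ {e | o ∉ e})).Reachable x b ∧
          1 ≤ (A.filter fun z => (openGraph (ω ∩ {e | o ∉ e})).Reachable x z).card ∧
          (A.filter fun z => (openGraph (ω ∩ {e | o ∉ e})).Reachable x z).card ≤ j} ≤
      (prodBernoulli w).real {ω : BondConfig (Fin n) |
        ¬ (openGraph (ω ∩ {e | o ∉ e})).Reachable x b ∧
          (A.filter fun z => (openGraph (ω ∩ {e | o ∉ e})).Reachable b z).card ≤ j} := by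
  haveI : IsProbabilityMeasure (prodBernoulli w) := inferInstance
  set u : Sym2 (Fin n) → unitInterval := fun e => if e ∈ {e : Sym2 (Fin n) | o ∉ e} then w e else 0 with hu
  haveI : IsProbabilityMeasure (prodBernoulli u) := inferInstance
  have hux : ∀ v, v ≠ o → u s(x, v) = w s(x, v) := by
    intro v hv
    have : o ∉ s(x, v) := by
      rw [Sym2.mem_iff, not_or]; exact ⟨hxo.symm, hv.symm⟩
    simp only [hu, mem_setOf_eq, this, not_false_eq_true, if_true]
  have huo : ∀ v, u s(v, o) = 0 := by
    intro v; simp only [hu, mem_setOf_eq, Sym2.mem_iff, or_true, not_true_eq_false, if_false]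
  set Lx := {ξ : BondConfig (Fin n) |
    1 ≤ (A.filter fun y => ξ ∈ openConn x y).card ∧ (A.filter fun y => ξ ∈ openConn x y).card ≤ j} with hLx
  set Tb := {ξ : BondConfig (Fin n) | (A.filter fun y => ξ ∈ openConn b y).card ≤ j} with hTb
  set D := {ξ : BondConfig (Fin n) | ¬ (openGraph ξ).Reachable x b} with hD
  have eL : {ω : BondConfig (Fin n) | ¬ (openGraph (ω ∩ {e | o ∉ e})).Reachable x b ∧
        1 ≤ (A.filter fun z => (openGraph (ω ∩ {e | o ∉ e})).Reachable x z).card ∧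
        (A.filter fun z => (openGraph (ω ∩ {e | o ∉ e})).Reachable x z).card ≤ j} =
      {ω : BondConfig (Fin n) | ω ∩ {e | o ∉ e} ∈ D ∩ Lx} := by
    ext ω; simp only [hD, hLx, mem_inter_iff, mem_setOf_eq, openConn]
  have eB : {ω : BondConfig (Fin n) | ¬ (openGraph (ω ∩ {e | o ∉ e})).Reachable x b ∧
        (A.filter fun z => (openGraph (ω ∩ {e | o ∉ e})).Reachable b z).card ≤ j} =
      {ω : BondConfig (Fin n) | ω ∩ {e | o ∉ e} ∈ D ∩ Tb} := by
    ext ω; simp only [hD, hTb, mem_inter_iff, mem_setOf_eq, openConn]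
  rw [eL, eB, measureReal_preimage_avoid, measureReal_preimage_avoid]
  change (prodBernoulli u).real (D ∩ Lx) ≤ (prodBernoulli u).real (D ∩ Tb)
  -- CIL for `x` in the graph `u` with witness `b`
  have hcil : (prodBernoulli u).real Lx ≤ (prodBernoulli u).real Tb := by
    set Qx := A.filter fun v => w s(x, v) ≠ 0 with hQx
    by_cases hQ : Qx.card = 0
    · have hiso : ∀ v, v ≠ x → u s(x, v) = 0 := by
        intro v hv
        by_cases hvo : v = o
        · rw [hvo]; exact huo x
        · rw [hux v hvo]
          by_contra hne
          have hvA := hx v hvo hne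
          have : v ∈ Qx := Finset.mem_filter.2 ⟨hvA, hne⟩
          rw [Finset.card_eq_zero] at hQ
          rw [hQ] at this
          exact absurd this (Finset.notMem_empty _)
      have h0 := measureReal_isolated_light_eq_zero u A x hxA hiso univ j
      rw [univ_inter] at h0
      rw [hLx, h0]
      exact measureReal_nonneg
    · set q : Fin Qx.card → Fin n := fun i => (Qx.equivFin.symm i).1 with hq
      have hqinj : Function.Injective q := by
        intro i i' h
        exact Qx.equivFin.symm.injective (Subtype.ext h)
      have hqA : ∀ i, q i ∈ A := fun i => (Finset.mem_filter.1 (Qx.equivFin.symm i).2).1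
      have hqw : ∀ i, w s(x, q i) ≠ 0 := fun i => (Finset.mem_filter.1 (Qx.equivFin.symm i).2).2
      have hobsx : ∀ v, u s(x, v) ≠ 0 → ∃ i, v = q i := by
        intro v hv
        have hvo : v ≠ o := by rintro rfl; exact hv (huo x)
        rw [hux v hvo] at hv
        have hvA : v ∈ A := hx v hvo hv
        have hvQ : v ∈ Qx := Finset.mem_filter.2 ⟨hvA, hv⟩
        refine ⟨Qx.equivFin ⟨v, hvQ⟩, ?_⟩
        simp only [hq, Equiv.symm_apply_apply]
      have hdomx : ∀ i,
          (prodBernoulli u).real {ξ : BondConfig (Fin n) | (A.filter fun y => ξ ∈ openConn (q i) y).card ≤ j} ≤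
            (prodBernoulli u).real {ξ : BondConfig (Fin n) | (A.filter fun y => ξ ∈ openConn b y).card ≤ j} := by
        intro i
        have h := hdom (q i) (hqA i) (hqw i)
        have e2 : ∀ z : Fin n, {ω : BondConfig (Fin n) |
              (A.filter fun y => (openGraph (ω ∩ {e | o ∉ e})).Reachable z y).card ≤ j} =
            {ω : BondConfig (Fin n) | ω ∩ {e | o ∉ e} ∈
              {ξ : BondConfig (Fin n) | (A.filter fun y => ξ ∈ openConn z y).card ≤ j}} := by
          intro z; ext ω; simp only [mem_setOf_eq, openConn]
        rw [e2 (q i), e2 b, measureReal_preimage_avoid, measureReal_preimage_avoid] at h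
        exact h
      exact cil_of_portDomination u A x j q hqinj hqA hxA (Nat.pos_of_ne_zero hQ) hobsx b hdomx
  -- subtract the common part on `{x ~ b}`
  have hcommon : Lx ∩ Dᶜ = Tb ∩ Dᶜ := by
    ext ξ
    simp only [hLx, hTb, hD, mem_inter_iff, mem_setOf_eq, mem_compl_iff, not_not]
    constructor
    · rintro ⟨⟨_, h2⟩, hr⟩
      refine ⟨?_, hr⟩
      have heq : (A.filter fun y => ξ ∈ openConn b y) = (A.filter fun y => ξ ∈ openConn x y) :=
        Finset.filter_congr fun y _ => ⟨fun h => hr.trans h, fun h => hr.symm.trans h⟩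
      rw [heq]; exact h2
    · rintro ⟨h2, hr⟩
      have heq : (A.filter fun y => ξ ∈ openConn x y) = (A.filter fun y => ξ ∈ openConn b y) :=
        Finset.filter_congr fun y _ => ⟨fun h => hr.symm.trans h, fun h => hr.trans h⟩
      refine ⟨⟨?_, ?_⟩, hr⟩
      · rw [heq]; exact Finset.card_pos.2 ⟨b, Finset.mem_filter.2 ⟨hbA, SimpleGraph.Reachable.refl _⟩⟩
      · rw [heq]; exact h2
  have sL := measureReal_inter_add_sdiff (μ := prodBernoulli u) (s := Lx) (MeasurableSet.of_discrete (s := D))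
    (measure_ne_top _ _)
  have sT := measureReal_inter_add_sdiff (μ := prodBernoulli u) (s := Tb) (MeasurableSet.of_discrete (s := D))
    (measure_ne_top _ _)
  have hdL : Lx \ D = Lx ∩ Dᶜ := by ext ξ; simp only [mem_sdiff, mem_inter_iff, mem_compl_iff]
  have hdT : Tb \ D = Tb ∩ Dᶜ := by ext ξ; simp only [mem_sdiff, mem_inter_iff, mem_compl_iff]
  rw [hdL, hcommon] at sL
  rw [hdT] at sT
  rw [inter_comm D Lx, inter_comm D Tb]
  linarith

/-- **Depth-two hulls: CIL from the split inequalities.**  Let `o ∉ A` be a depth-two observer: every positive-weight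
neighbour of `o` is a relay or a non-relay `x` whose other positive-weight pairs all end in relays.  Let `b ∈ A` be at least
as `H`-light as every relay adjacent to `o` or to a non-relay neighbour of `o` (`H` = pairs at `o` removed).  IF for every
finite set `B` of at least two non-relay neighbours of `o` the inequality
`CS_H(B, b) : μ(b ≁' B, 1 ≤ |π'(B)| ≤ j) ≤ μ(b ≁' B, |π'(b)| ≤ j)` holds (the split(|B|) instances of HULLPORT-COUPLING.md),
THEN `μ{1 ≤ N ≤ j} ≤ μ{|π(b)| ≤ j}`.  Star transfer (`Theorems.cil_of_starStability`) + `steiner_singleton_CS`. [this file] -/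
theorem cil_depthTwo_of_split (w : Sym2 (Fin n) → unitInterval) (A : Finset (Fin n)) (o : Fin n) (j : ℕ)
    (hoA : o ∉ A)
    (hdepth : ∀ x, x ≠ o → x ∉ A → w s(o, x) ≠ 0 → ∀ v, v ≠ o → w s(x, v) ≠ 0 → v ∈ A)
    (b : Fin n) (hbA : b ∈ A)
    (hdomO : ∀ q ∈ A, w s(o, q) ≠ 0 →
      (prodBernoulli w).real {ω : BondConfig (Fin n) |
          (A.filter fun z => (openGraph (ω ∩ {e | o ∉ e})).Reachable q z).card ≤ j} ≤
        (prodBernoulli w).real {ω : BondConfig (Fin n) |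
          (A.filter fun z => (openGraph (ω ∩ {e | o ∉ e})).Reachable b z).card ≤ j})
    (hdomX : ∀ x, x ≠ o → x ∉ A → w s(o, x) ≠ 0 → ∀ q ∈ A, w s(x, q) ≠ 0 →
      (prodBernoulli w).real {ω : BondConfig (Fin n) |
          (A.filter fun z => (openGraph (ω ∩ {e | o ∉ e})).Reachable q z).card ≤ j} ≤
        (prodBernoulli w).real {ω : BondConfig (Fin n) |
          (A.filter fun z => (openGraph (ω ∩ {e | o ∉ e})).Reachable b z).card ≤ j})
    (hsplit : ∀ B : Finset (Fin n), 2 ≤ B.card → (∀ y ∈ B, y ≠ o ∧ y ∉ A ∧ w s(o, y) ≠ 0) →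
      (prodBernoulli w).real {ω : BondConfig (Fin n) |
          (∀ y ∈ B, ¬ (openGraph (ω ∩ {e | o ∉ e})).Reachable b y) ∧
            1 ≤ (A.filter fun z => ∃ y ∈ B, (openGraph (ω ∩ {e | o ∉ e})).Reachable y z).card ∧
            (A.filter fun z => ∃ y ∈ B, (openGraph (ω ∩ {e | o ∉ e})).Reachable y z).card ≤ j} ≤
        (prodBernoulli w).real {ω : BondConfig (Fin n) |
          (∀ y ∈ B, ¬ (openGraph (ω ∩ {e | o ∉ e})).Reachable b y) ∧
            (A.filter fun z => (openGraph (ω ∩ {e | o ∉ e})).Reachable b z).card ≤ j}) :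
    (prodBernoulli w).real {ω : BondConfig (Fin n) |
        1 ≤ (A.filter fun x => ω ∈ openConn o x).card ∧ (A.filter fun x => ω ∈ openConn o x).card ≤ j} ≤
      (prodBernoulli w).real {ω : BondConfig (Fin n) | (A.filter fun x => ω ∈ openConn b x).card ≤ j} := by
  have hbo : b ≠ o := fun h => hoA (h ▸ hbA)
  refine cil_of_starStability w A o b j hoA hbo ?_
  intro B hBne hB
  -- no member of a light star is a relay
  have hBA : ∀ y ∈ B, y ∉ A := by
    intro y hy hyA
    obtain ⟨hyo, hwy, hlt⟩ := hB y hy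
    exact absurd (hdomO y hyA hwy) (not_le.2 hlt)
  by_cases hcard : 2 ≤ B.card
  · exact hsplit B hcard fun y hy => ⟨(hB y hy).1, hBA y hy, (hB y hy).2.1⟩
  · -- a singleton Steiner star
    have hc1 : B.card = 1 := by
      have := Finset.card_pos.2 hBne
      omega
    obtain ⟨x, hBx⟩ := Finset.card_eq_one.1 hc1
    subst hBx
    obtain ⟨hxo, hwx, _⟩ := hB x (Finset.mem_singleton_self x)
    have hxA : x ∉ A := hBA x (Finset.mem_singleton_self x)
    have key := steiner_singleton_CS w A o x j hxA hxo (hdepth x hxo hxA hwx) b hbA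
      (fun q hq hwq => hdomX x hxo hxA hwx q hq hwq)
    have e1 : {ω : BondConfig (Fin n) |
          (∀ y ∈ ({x} : Finset (Fin n)), ¬ (openGraph (ω ∩ {e | o ∉ e})).Reachable b y) ∧
            1 ≤ (A.filter fun z => ∃ y ∈ ({x} : Finset (Fin n)), (openGraph (ω ∩ {e | o ∉ e})).Reachable y z).card ∧
            (A.filter fun z => ∃ y ∈ ({x} : Finset (Fin n)), (openGraph (ω ∩ {e | o ∉ e})).Reachable y z).card ≤ j} =
        {ω : BondConfig (Fin n) | ¬ (openGraph (ω ∩ {e | o ∉ e})).Reachable x b ∧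
            1 ≤ (A.filter fun z => (openGraph (ω ∩ {e | o ∉ e})).Reachable x z).card ∧
            (A.filter fun z => (openGraph (ω ∩ {e | o ∉ e})).Reachable x z).card ≤ j} := by
      ext ω
      simp only [mem_setOf_eq, Finset.mem_singleton, forall_eq, exists_eq_left]
      constructor
      · rintro ⟨h1, h2⟩; exact ⟨fun h => h1 h.symm, h2⟩
      · rintro ⟨h1, h2⟩; exact ⟨fun h => h1 h.symm, h2⟩
    have e2 : {ω : BondConfig (Fin n) |
          (∀ y ∈ ({x} : Finset (Fin n)), ¬ (openGraph (ω ∩ {e | o ∉ e})).Reachable b y) ∧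
            (A.filter fun z => (openGraph (ω ∩ {e | o ∉ e})).Reachable b z).card ≤ j} =
        {ω : BondConfig (Fin n) | ¬ (openGraph (ω ∩ {e | o ∉ e})).Reachable x b ∧
            (A.filter fun z => (openGraph (ω ∩ {e | o ∉ e})).Reachable b z).card ≤ j} := by
      ext ω
      simp only [mem_setOf_eq, Finset.mem_singleton, forall_eq]
      constructor
      · rintro ⟨h1, h2⟩; exact ⟨fun h => h1 h.symm, h2⟩
      · rintro ⟨h1, h2⟩; exact ⟨fun h => h1 h.symm, h2⟩
    rw [e1, e2]
    exact key

end HullPort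

end Summit.CriticalPhenomena.PercolationContinuityZ3.Theorems

end
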